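import Literature.Analysis.FluidPDE.PassiveScalarDiagMildForcedWeakForm
import Literature.Analysis.FluidPDE.PassiveScalarDiagMildForcedFreeTerm
import Literature.Analysis.FluidPDE.PassiveScalarDiagMildPicard
import Literature.Analysis.FluidPDE.PassiveScalarDiagMildTails
import Literature.Analysis.FluidPDE.PassiveScalarDiagForced
import HarnessLib

/-!
# Mild (Duhamel) formulation of the passive scalar equation with constant diagonal diffusion and
  bounded drift: the mild solution of the FORCED equation

Analysis/FluidPDE proof-support file (everything proved). For `T > 0`, `κ > 0`, `aᵢ > 0`, a drift
bounded by `U` on `(0,T) × T^d`, `θ₀ ∈ L²` and a source `s ∈ L²((0,T) × T^d)` (`Torus.SourceL2`):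

* `Torus.exists_forcedMildSolution` — the Picard iteration of `PassiveScalarDiagMildPicard` with the
  free term `Torus.forcedFreeTerm` (damping `λ = 2(∑ⱼaⱼ⁻¹)U²/κ + 1`), undamped by `e^{λt}`: an
  `L^∞_t L²_x` field with time-continuous Fourier coefficients satisfying the undamped FORCED mild
  equation `𝓕(θ(t))(k) = e^{-νₖt}θ̂₀(k) - ∫₀ᵗe^{-νₖ(t-τ)}N(θ)(τ)(k)dτ + ∫₀ᵗe^{-νₖ(t-τ)}ŝ(τ)(k)dτ` on
  `[0,T]` (Pazy 1983, Ch. 4 Cor. 2.5), with frequency tails small uniformly in time (datum, source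
  and transport tails);
* `Torus.ae_eq_datum_of_forcedMild` — `θ(0) = θ₀` a.e.;
* `Torus.isWeakScalarTransportDiagForcedOn_of_forcedMild` — such a field lies in the forced weak
  class `Torus.IsWeakScalarTransportDiagForcedOn` (weak formulation `weak_eq_of_forcedMild`, the
  other clauses from the bounds).

The sequel `PassiveScalarDiagForcedExistence` assembles the existence theorem with the strongly
`L²`-continuous representative.

## References

* A. Pazy, *Semigroups of Linear Operators and Applications to PDE*, Springer 1983, Ch. 4 §4.2
  (mild solutions, (2.3), Def. 2.3, Cor. 2.5), Ch. 6 §6.1 Thm. 1.2 (Picard iteration).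
* R. J. DiPerna, P.-L. Lions, Invent. Math. 98 (1989) 511–547, §II.1.
* L. Grafakos, *Classical Fourier Analysis*, 3rd ed. (2014), Prop. 3.2.6 (4), Prop. 3.2.7 (3).
-/

noncomputable section

open MeasureTheory TopologicalSpace Set Function Filter UnitAddTorus
open _root_.Topology
open scoped ENNReal NNReal InnerProductSpace ComplexConjugate

namespace Literature.Analysis.FluidPDE

namespace Torus

open Literature.Analysis.FunctionSpaces.Torus Literature.Analysis.FunctionSpaces

variable {d : Type*} [Fintype d]

section ForcedMild

variable [DecidableEq d]
variable {T U E Es κ lam : ℝ} {a : d → ℝ} {u : ℝ → UnitAddTorus d → EuclideanSpace ℝ d}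
  {θ : ℝ → UnitAddTorus d → ℝ} {θ₀ : UnitAddTorus d → ℝ} {s : ℝ → UnitAddTorus d → ℝ}

omit [DecidableEq d] in
/-- `‖a + b - c‖² ≤ 3(‖a‖² + ‖b‖² + ‖c‖²)`. [cite: Grafakos2014, Prop. 3.2.7 (3)] -/
private theorem norm_add_sub_sq_le_three (x y z : ℂ) : ‖x + y - z‖ ^ 2 ≤ 3 * (‖x‖ ^ 2 + ‖y‖ ^ 2 + ‖z‖ ^ 2) := by
  have h : ‖x + y - z‖ ≤ ‖x‖ + ‖y‖ + ‖z‖ := by linarith [norm_sub_le (x + y) z, norm_add_le x y]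
  nlinarith [norm_nonneg (x + y - z), norm_nonneg x, norm_nonneg y, norm_nonneg z,
    sq_nonneg (‖x‖ - ‖y‖), sq_nonneg (‖y‖ - ‖z‖), sq_nonneg (‖x‖ - ‖z‖)]

variable [Nonempty d]

/-- **Existence of a forced mild solution** (Pazy 1983, Ch. 4 Cor. 2.5 with Ch. 6 Thm. 1.2's Picard
iteration, here run in `L^∞_t ℓ²_k` after exponential damping): for `T > 0`, `κ > 0`, `aᵢ > 0`, a
drift bounded by `U`, `θ₀ ∈ L²` and a source `s ∈ L²((0,T) × T^d)`, there is an `L^∞_t L²_x` field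
`θ` on `[0,T]`, with time-continuous Fourier coefficients, satisfying the undamped FORCED mild
equation `𝓕(θ(t))(k) = e^{-νₖt}θ̂₀(k) - ∫_{(0,t]}e^{-νₖ(t-τ)}N(θ)(τ)(k)dτ + ∫_{(0,t]}e^{-νₖ(t-τ)}ŝ(τ)(k)dτ`
on `[0,T]`, whose frequency tails are small uniformly in `t ∈ [0,T]` (`θ = e^{λt}w` for the fixed
point `w` of `PicardData.exists_fixedPoint` with the free term `forcedFreeTerm`). [cite: Pazy1983, Ch. 4 §4.2, Cor. 2.5 (inhomogeneous problem), p. 107] -/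
theorem exists_forcedMildSolution (hT : 0 < T) (hκ : 0 < κ) (ha : ∀ i, 0 < a i) (hU : DriftBound T u U)
    (hθ₀ : MemLp θ₀ 2 volume) (hs : SourceL2 T s Es) :
    ∃ θ : ℝ → UnitAddTorus d → ℝ, ∃ E : ℝ, IsL2Field T E θ ∧
      (∀ k, ContinuousOn (fun t => mFourierCoeff (fun x => (θ t x : ℂ)) k) (Icc 0 T)) ∧
      (∀ t ∈ Icc 0 T, ∀ k, mFourierCoeff (fun x => (θ t x : ℂ)) k =
        mildMap κ a 0 u θ₀ θ t k + sourceDuhamel κ a 0 s t k) ∧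
      (∀ ε : ℝ, 0 < ε → ∃ N : ℕ, ∀ t ∈ Icc 0 T, ∀ F : Finset (d → ℤ),
        ∑ k ∈ F \ freqBall N, ‖mFourierCoeff (fun x => (θ t x : ℂ)) k‖ ^ 2 ≤ ε) := by
  -- the damping rate and the Picard data
  set lam : ℝ := 2 * (∑ j, (a j)⁻¹) * U ^ 2 / κ + 1 with hlam_def
  have hlam : 0 < lam := by
    have : 0 ≤ ∑ j, (a j)⁻¹ := Finset.sum_nonneg fun j _ => inv_nonneg.2 (ha j).le
    positivity
  have ha' : ∀ i, 0 ≤ a i := fun i => (ha i).le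
  set Q : PicardData d :=
    { T := T, κ := κ, lam := lam, U := U, a := a, u := u, f := forcedFreeTerm κ a lam s θ₀,
      Af := Real.sqrt (∫ x, θ₀ x ^ 2) + Real.sqrt (Es / (2 * lam)),
      hT := hT, hκ := hκ, hlam := hlam, ha := ha, hu := hU,
      hf := isMildCoeff_forcedFreeTerm hκ.le ha' hlam hθ₀ hs, hq := contraction_const_le hκ ha U } with hQ
  obtain ⟨w, hw, hwc, hweq⟩ := Q.exists_fixedPoint
  -- the undamped field
  set θ : ℝ → UnitAddTorus d → ℝ := fun t x => Real.exp (lam * t) * w t x with hθdef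
  have hθF : ∀ t k, mFourierCoeff (fun x => (θ t x : ℂ)) k =
      ((Real.exp (lam * t) : ℝ) : ℂ) * mFourierCoeff (fun x => (w t x : ℂ)) k := by
    intro t k
    have e : (fun x => (θ t x : ℂ)) = ((Real.exp (lam * t) : ℝ) : ℂ) • fun x => ((w t x : ℝ) : ℂ) := by
      funext x; simp only [hθdef, Pi.smul_apply, smul_eq_mul]; push_cast; ring
    rw [e, mFourierCoeff_const_smul, smul_eq_mul]
  have hR : ∀ t ∈ Icc 0 T, Real.exp (lam * t) ^ 2 ≤ Real.exp (lam * T) ^ 2 := fun t ht =>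
    pow_le_pow_left₀ (Real.exp_pos _).le (Real.exp_le_exp.2 (mul_le_mul_of_nonneg_left ht.2 hlam.le)) 2
  have hθ : IsL2Field T (Real.exp (lam * T) ^ 2 * Q.R ^ 2) θ :=
    hw.mul_continuous (f := fun t => Real.exp (lam * t)) (by fun_prop) hR
  refine ⟨θ, _, hθ, fun k => ?_, fun t ht k => ?_, fun ε hε => ?_⟩
  · -- continuity of the coefficients
    have h : ContinuousOn (fun t => ((Real.exp (lam * t) : ℝ) : ℂ) * mFourierCoeff (fun x => (w t x : ℂ)) k)
        (Icc 0 T) := (Complex.continuous_ofReal.comp (by fun_prop)).continuousOn.mul (hwc k)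
    exact h.congr fun t _ => hθF t k
  · -- the undamped forced mild equation
    rw [hθF t k, hweq t ht k, mul_sub, mildMap_eq_heatFamily_sub]
    show ((Real.exp (lam * t) : ℝ) : ℂ) * forcedFreeTerm κ a lam s θ₀ t k -
        ((Real.exp (lam * t) : ℝ) : ℂ) * duhamelCoeff κ a lam u w t k =
      heatFamily κ a 0 θ₀ t k - duhamelCoeff κ a 0 u θ t k + sourceDuhamel κ a 0 s t k
    rw [exp_mul_forcedFreeTerm, hθdef, duhamelCoeff_zero_exp_mul]
    ring
  · -- uniform tails: datum, source and transport parts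
    set Rc : ℝ := Real.exp (lam * T) ^ 2 with hRc
    have hRc0 : 0 < Rc := by positivity
    have hε' : 0 < ε / (9 * Rc) := by positivity
    have hdat : Tendsto (fun N => ∫ x, (θ₀ x - scalarTruncate N θ₀ x) ^ 2) atTop (𝓝 0) :=
      tendsto_integral_sq_sub_scalarTruncate hθ₀
    obtain ⟨N₁, hN₁⟩ := (hdat.eventually (gt_mem_nhds hε')).exists_forall_of_atTop
    obtain ⟨N₂, hN₂⟩ := exists_sum_sdiff_norm_sq_duhamelCoeff_le (κ := κ) (a := a) (lam := lam) hU hw ha hκ hlam hε'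
    obtain ⟨N₃, hN₃⟩ := exists_sum_sdiff_norm_sq_sourceDuhamel_le (κ := κ) (a := a) (lam := lam)
      (hs.exp_neg_mul hlam.le) hκ.le ha' hlam hε'
    set N := max N₁ (max N₂ N₃) with hN
    refine ⟨N, fun t ht F => ?_⟩
    have hsub : ∀ {M M' : ℕ}, M ≤ M' → F \ freqBall M' ⊆ F \ freqBall M := fun h =>
      Finset.sdiff_subset_sdiff subset_rfl (freqBall_mono h)
    have hN1 : N₁ ≤ N := le_max_left _ _
    have hN2 : N₂ ≤ N := (le_max_left _ _).trans (le_max_right _ _)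
    have hN3 : N₃ ≤ N := (le_max_right _ _).trans (le_max_right _ _)
    -- pointwise bound of a coefficient
    have hpt : ∀ k, ‖mFourierCoeff (fun x => (θ t x : ℂ)) k‖ ^ 2 ≤
        Rc * (3 * (‖mFourierCoeff (fun x => (θ₀ x : ℂ)) k‖ ^ 2 +
          ‖sourceDuhamel κ a lam (fun τ x => Real.exp (-(lam * τ)) * s τ x) t k‖ ^ 2 +
          ‖duhamelCoeff κ a lam u w t k‖ ^ 2)) := by
      intro k
      rw [hθF t k, hweq t ht k, norm_mul, mul_pow, Complex.norm_real, Real.norm_of_nonneg (Real.exp_pos _).le]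
      refine mul_le_mul (hR t ht) ?_ (sq_nonneg _) hRc0.le
      show ‖forcedFreeTerm κ a lam s θ₀ t k - duhamelCoeff κ a lam u w t k‖ ^ 2 ≤ _
      rw [forcedFreeTerm_apply]
      refine (norm_add_sub_sq_le_three _ _ _).trans (mul_le_mul_of_nonneg_left ?_ (by norm_num))
      refine add_le_add (add_le_add ?_ le_rfl) le_rfl
      rw [heatFamily_apply, norm_mul, mul_pow, Complex.norm_real, Real.norm_of_nonneg (Real.exp_pos _).le]
      have h1 : Real.exp (-((diagRate κ a k + lam) * t)) ≤ 1 := by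
        rw [Real.exp_le_one_iff, neg_nonpos]
        exact mul_nonneg (add_nonneg (diagRate_nonneg hκ.le ha' k) hlam.le) ht.1
      calc Real.exp (-((diagRate κ a k + lam) * t)) ^ 2 * ‖mFourierCoeff (fun x => (θ₀ x : ℂ)) k‖ ^ 2
          ≤ 1 ^ 2 * ‖mFourierCoeff (fun x => (θ₀ x : ℂ)) k‖ ^ 2 := by gcongr
        _ = _ := by rw [one_pow, one_mul]
    -- the three tails
    have hdat' : ∑ k ∈ F \ freqBall N, ‖mFourierCoeff (fun x => (θ₀ x : ℂ)) k‖ ^ 2 ≤ ε / (9 * Rc) := by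
      refine le_trans ?_ (hN₁ N hN1).le
      rw [integral_sq_sub_scalarTruncate hθ₀, le_sub_iff_add_le, ← Finset.sum_union Finset.sdiff_disjoint]
      exact sum_le_hasSum _ (fun _ _ => sq_nonneg _) (hasSum_sq_norm_mFourierCoeff_ofReal hθ₀)
    have hsrc : ∑ k ∈ F \ freqBall N,
        ‖sourceDuhamel κ a lam (fun τ x => Real.exp (-(lam * τ)) * s τ x) t k‖ ^ 2 ≤ ε / (9 * Rc) :=
      (Finset.sum_le_sum_of_subset_of_nonneg (hsub hN3) fun _ _ _ => sq_nonneg _).trans (hN₃ t ht F)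
    have hduh : ∑ k ∈ F \ freqBall N, ‖duhamelCoeff κ a lam u w t k‖ ^ 2 ≤ ε / (9 * Rc) :=
      (Finset.sum_le_sum_of_subset_of_nonneg (hsub hN2) fun _ _ _ => sq_nonneg _).trans (hN₂ t ht F)
    calc ∑ k ∈ F \ freqBall N, ‖mFourierCoeff (fun x => (θ t x : ℂ)) k‖ ^ 2
        ≤ ∑ k ∈ F \ freqBall N, Rc * (3 * (‖mFourierCoeff (fun x => (θ₀ x : ℂ)) k‖ ^ 2 +
            ‖sourceDuhamel κ a lam (fun τ x => Real.exp (-(lam * τ)) * s τ x) t k‖ ^ 2 +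
            ‖duhamelCoeff κ a lam u w t k‖ ^ 2)) := Finset.sum_le_sum fun k _ => hpt k
      _ = Rc * (3 * (∑ k ∈ F \ freqBall N, ‖mFourierCoeff (fun x => (θ₀ x : ℂ)) k‖ ^ 2 +
            ∑ k ∈ F \ freqBall N, ‖sourceDuhamel κ a lam (fun τ x => Real.exp (-(lam * τ)) * s τ x) t k‖ ^ 2 +
            ∑ k ∈ F \ freqBall N, ‖duhamelCoeff κ a lam u w t k‖ ^ 2)) := by
          rw [← Finset.mul_sum, ← Finset.mul_sum, Finset.sum_add_distrib, Finset.sum_add_distrib]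
      _ ≤ Rc * (3 * (ε / (9 * Rc) + ε / (9 * Rc) + ε / (9 * Rc))) := by
          gcongr
      _ = ε := by field_simp; ring

omit [DecidableEq d] [Nonempty d] in
/-- **The forced mild solution attains the datum**: `𝓕(θ(0)) = θ̂₀` (both Duhamel integrals over
`(0,0]` vanish), hence `θ(0) = θ₀` a.e. [cite: Pazy1983, Ch. 4 §4.2, Cor. 2.5 (inhomogeneous problem), p. 107] -/
theorem ae_eq_datum_of_forcedMild (hT : 0 ≤ T) (hθ : IsL2Field T E θ) (hθ₀ : MemLp θ₀ 2 volume)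
    (hmild : ∀ t ∈ Icc 0 T, ∀ k, mFourierCoeff (fun x => (θ t x : ℂ)) k =
      mildMap κ a 0 u θ₀ θ t k + sourceDuhamel κ a 0 s t k) :
    θ 0 =ᵐ[volume] θ₀ := by
  refine ae_eq_of_forall_mFourierCoeff_ofReal_eq ((hθ.memLp 0 (left_mem_Icc.2 hT)).integrable one_le_two)
    (hθ₀.integrable one_le_two) fun k => ?_
  rw [hmild 0 (left_mem_Icc.2 hT) k, mildMap_apply, duhamelCoeff_apply, sourceDuhamel_time_zero]
  simp

omit [Nonempty d] in
/-- **A forced mild solution lies in the forced weak class** `Torus.IsWeakScalarTransportDiagForcedOn`: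
an `L^∞_t L²_x` field with continuous Fourier coefficients satisfying the undamped forced mild
equation for a bounded, weakly divergence-free drift and an `L²_{t,x}` source is a weak
(distributional) solution of `∂ₜθ + u·∇θ = κ∑ᵢaᵢ∂ᵢ∂ᵢθ + s`, `θ(0) = θ₀` on `T^d × [0,T)` (the weak
formulation is `weak_eq_of_forcedMild`; the other clauses of the class follow from the bounds). [cite: DiPernaLions1989, §II.1 (12)–(14)] -/
theorem isWeakScalarTransportDiagForcedOn_of_forcedMild (hT : 0 < T) (hκ : 0 ≤ κ) (ha : ∀ i, 0 < a i)
    (hu : MemLp (stLift u) ∞ (volume.restrict (Ioo 0 T ×ˢ univ))) (hU : DriftBound T u U)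
    (hdiv : ∀ᵐ t ∂((volume : Measure ℝ).restrict (Ioo 0 T)), FunctionSpaces.Torus.IsWeaklyDivFree (u t))
    (hθ : IsL2Field T E θ) (hθ₀ : MemLp θ₀ 2 volume) (hs : SourceL2 T s Es)
    (hcont : ∀ k, ContinuousOn (fun t => mFourierCoeff (fun x => (θ t x : ℂ)) k) (Icc 0 T))
    (hmild : ∀ t ∈ Icc 0 T, ∀ k, mFourierCoeff (fun x => (θ t x : ℂ)) k =
      mildMap κ a 0 u θ₀ θ t k + sourceDuhamel κ a 0 s t k) :
    IsWeakScalarTransportDiagForcedOn T a κ u s θ₀ θ := by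
  haveI : IsFiniteMeasure ((volume : Measure ℝ).restrict (Ioo 0 T)) :=
    isFiniteMeasure_restrict.2 measure_Ioo_lt_top.ne
  obtain ⟨Cu', -, hCu'⟩ := ae_ae_norm_le_of_memLp_top_stLift hu
  have hWb : ∀ᵐ t ∂((volume : Measure ℝ).restrict (Ioo 0 T)), ∫⁻ x, ‖θ t x‖ₑ ^ 2 ≤ (E.toNNReal : ℝ≥0∞) := by
    filter_upwards [ae_restrict_mem measurableSet_Ioo] with t ht
    exact hθ.lintegral_sq_le (Ioo_subset_Icc_self ht)
  have hWs : ∀ᵐ t ∂((volume : Measure ℝ).restrict (Ioo 0 T)), AEStronglyMeasurable (θ t) volume :=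
    hθ.aestronglyMeasurable.prodMk_left
  have hu2 : ∀ᵐ t ∂((volume : Measure ℝ).restrict (Ioo 0 T)), ∫⁻ x, ‖u t x‖ₑ ^ 2 ≤ ENNReal.ofReal Cu' ^ 2 := by
    filter_upwards [hCu'] with t ht
    calc ∫⁻ x, ‖u t x‖ₑ ^ 2 ≤ ∫⁻ _ : UnitAddTorus d, ENNReal.ofReal Cu' ^ 2 := by
          refine lintegral_mono_ae ?_
          filter_upwards [ht] with x hx
          gcongr
          rw [← ofReal_norm]
          exact ENNReal.ofReal_le_ofReal hx
      _ = ENNReal.ofReal Cu' ^ 2 := by rw [lintegral_const, measure_univ, mul_one]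
  refine ⟨aestronglyMeasurable_stLift_of_uncurry hθ.aestronglyMeasurable, hu.1, hs.aestronglyMeasurable_stLift,
    ⟨E.toNNReal, hWb⟩, ?_, ?_, hs.lintegral_lintegral_enorm_lt_top, hdiv,
    fun ψ hψ => weak_eq_of_forcedMild hT hκ ha hU hθ hθ₀ hs hcont hmild hψ⟩
  · -- `u ∈ L¹(0,T; L²)`
    calc ∫⁻ t in Ioo 0 T, (∫⁻ x, ‖u t x‖ₑ ^ 2) ^ (1 / 2 : ℝ)
        ≤ ∫⁻ _ in Ioo 0 T, (ENNReal.ofReal Cu' ^ 2) ^ (1 / 2 : ℝ) := by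
          refine lintegral_mono_ae ?_
          filter_upwards [hu2] with t ht
          exact ENNReal.rpow_le_rpow ht (by norm_num)
      _ < ⊤ := by
          rw [lintegral_const, Measure.restrict_apply_univ]
          exact ENNReal.mul_lt_top (ENNReal.rpow_lt_top_of_nonneg (by norm_num)
            (ENNReal.pow_ne_top ENNReal.ofReal_ne_top)) measure_Ioo_lt_top
  · -- `u θ ∈ L¹((0,T) × T^d)`
    calc ∫⁻ t in Ioo 0 T, ∫⁻ x, ‖u t x‖ₑ * ‖θ t x‖ₑ
        ≤ ∫⁻ _ in Ioo 0 T, ENNReal.ofReal Cu' * ((E.toNNReal : ℝ≥0∞)) ^ (1 / 2 : ℝ) := by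
          refine lintegral_mono_ae ?_
          filter_upwards [hCu', hWb, hWs] with t ht htW htm
          calc ∫⁻ x, ‖u t x‖ₑ * ‖θ t x‖ₑ ≤ ∫⁻ x, ENNReal.ofReal Cu' * ‖θ t x‖ₑ := by
                refine lintegral_mono_ae ?_
                filter_upwards [ht] with x hx
                gcongr
                rw [← ofReal_norm]
                exact ENNReal.ofReal_le_ofReal hx
            _ = ENNReal.ofReal Cu' * eLpNorm (θ t) 1 volume := by
                rw [lintegral_const_mul' _ _ ENNReal.ofReal_ne_top, eLpNorm_one_eq_lintegral_enorm]
            _ ≤ ENNReal.ofReal Cu' * eLpNorm (θ t) 2 volume := by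
                gcongr
                exact eLpNorm_le_eLpNorm_of_exponent_le one_le_two htm
            _ ≤ ENNReal.ofReal Cu' * ((E.toNNReal : ℝ≥0∞)) ^ (1 / 2 : ℝ) := by
                gcongr
                rw [FunctionSpaces.eLpNorm_two_eq_pow_two_rpow_half, FunctionSpaces.eLpNorm_two_pow_two_eq_lintegral]
                exact ENNReal.rpow_le_rpow htW (by norm_num)
      _ < ⊤ := by
          rw [lintegral_const, Measure.restrict_apply_univ]
          exact ENNReal.mul_lt_top (ENNReal.mul_lt_top ENNReal.ofReal_lt_top
            (ENNReal.rpow_lt_top_of_nonneg (by norm_num) ENNReal.coe_ne_top)) measure_Ioo_lt_top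

end ForcedMild

end Torus

end Literature.Analysis.FluidPDE

end
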